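import Summits.CriticalPhenomena.CardyFormulaZ2.Theorems.CardySusyWardDiscretisationFamilyExistsCover
import Summits.CriticalPhenomena.CardyFormulaZ2.Theorems.CardySusyWardDiscretisationFamilyExistsLocalSearch
import Mathlib.Analysis.InnerProductSpace.Convex
import HarnessLib

/-!
# Degenerate pairs of boundary sites — helper for `DiscretisationFamilyExists` (stmt-CriticalPhenomena-9644)

Write `r x = infDist (δx) ∂Ω`.  For two lattice neighbours `u`, `v = u + cornerUnit m` the pair is
**degenerate** (the disc of `v` inside that of `u`, the obstruction to cutting between `u` and `v`
isolated by the far-pole criterion `…ExistsFarPole`) iff `δ + r v ≤ r u`.  This file records the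
rigid geometry of a degenerate pair:

* `infDist_eq_add_of_degenerate`: then `r u = r v + δ` exactly (`r` is `1`-Lipschitz);
* `infDist_le_of_degenerate`: and `r v ≤ (√2 - 1) δ < δ/2` if `u` is a boundary site;
* `foot_eq_farPole`: every nearest boundary point of `δv` is the FAR POLE `δv + (r v / δ)·δe`,
  `e = cornerUnit m` (equality in the triangle inequality, strict convexity of `ℂ`);
* `exists_foot`: nearest boundary points exist;
* `eq_of_degenerate_of_degenerate`: hence the partner `u` of a degenerate `v` is unique;
* `not_degenerate_of_foot_mem_openSegment`: a site with a nearest boundary point on the open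
  lattice segment towards a neighbour `z`, at distance `< δ`, forms a non-degenerate pair with `z`
  (both ways) — in particular (`not_degenerate_succ_of_degenerate`) the edge continuing a
  degenerate pair beyond its small site is non-degenerate, and so are the perpendicular edges at
  the small site (`not_degenerate_perp_of_degenerate`).
-/

noncomputable section

open Set Metric
open Literature.Probability.LatticeModels Literature.Probability.Percolation

namespace Summit.CriticalPhenomena.CardyFormulaZ2.Theorems.DiscretisationFamilyExists

/-! ### The distance to the boundary along a pair -/

/-- `r` is `1`-Lipschitz along a lattice edge: `r (v + e) ≤ r v + δ`. [folklore] -/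
theorem infDist_add_cornerUnit_le {Ω : Set ℂ} {δ : ℝ} (hδ : 0 < δ) (v : Site 2) (m : Fin 4) :
    infDist (meshPoint δ (v + cornerUnit m)) (frontier Ω) ≤ infDist (meshPoint δ v) (frontier Ω) + δ := by
  have := infDist_le_infDist_add_dist (s := frontier Ω) (x := meshPoint δ (v + cornerUnit m)) (y := meshPoint δ v)
  rwa [dist_meshPoint_add, norm_meshPoint_cornerUnit, abs_of_pos hδ] at this

/-- In a degenerate pair (`δ + r v ≤ r u`, `v = u + cornerUnit m`) the radii differ by exactly
`δ`. [folklore] -/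
theorem infDist_eq_add_of_degenerate {Ω : Set ℂ} {δ : ℝ} (hδ : 0 < δ) (u : Site 2) (m : Fin 4)
    (h : δ + infDist (meshPoint δ (u + cornerUnit m)) (frontier Ω) ≤ infDist (meshPoint δ u) (frontier Ω)) :
    infDist (meshPoint δ u) (frontier Ω) = infDist (meshPoint δ (u + cornerUnit m)) (frontier Ω) + δ := by
  refine le_antisymm ?_ (by linarith)
  have := infDist_add_cornerUnit_le (Ω := Ω) hδ (u + cornerUnit m) (m + 2)
  rwa [add_assoc, cornerUnit_add_two, add_neg_cancel, add_zero] at this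

/-- In a degenerate pair with `u` a boundary site, the small radius is at most `(√2 - 1) δ`, in
particular `< δ / 2`. [folklore] -/
theorem infDist_lt_half_of_degenerate {E : DiscreteDobrushin} (hΩ : IsOpen E.Ω) (hδ : 0 < E.δ)
    {u : Site 2} (hu : u ∈ E.zdBoundary) (m : Fin 4)
    (h : E.δ + infDist (meshPoint E.δ (u + cornerUnit m)) (frontier E.Ω) ≤
      infDist (meshPoint E.δ u) (frontier E.Ω)) :
    infDist (meshPoint E.δ (u + cornerUnit m)) (frontier E.Ω) < E.δ / 2 := by
  have h1 := infDist_frontier_le_sqrt_two hΩ hδ hu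
  have h2 : Real.sqrt 2 < 3 / 2 := by
    rw [show (3:ℝ) / 2 = Real.sqrt ((3/2) ^ 2) by rw [Real.sqrt_sq (by norm_num)]]
    exact Real.sqrt_lt_sqrt (by norm_num) (by norm_num)
  nlinarith

/-! ### Feet (nearest boundary points) -/

/-- A nearest boundary point exists (the frontier of a bounded nonempty open proper… we only need
it closed and nonempty; `ℂ` is proper). [folklore] -/
theorem exists_foot {Ω : Set ℂ} (hne : (frontier Ω).Nonempty) (p : ℂ) :
    ∃ f ∈ frontier Ω, infDist p (frontier Ω) = dist p f :=
  isClosed_frontier.exists_infDist_eq_dist hne p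

/-- **In a degenerate pair every foot of the small site is its far pole.** If
`δ + r v ≤ r u` with `v = u + cornerUnit m` and `f ∈ ∂Ω` is at distance `r v` from `δv`, then
`f = δv + (r v / δ) · δ(cornerUnit m)`: indeed `dist (δu) f ≥ r u = δ + r v = dist (δu) (δv) +
dist (δv) f`, equality in the triangle inequality. [folklore] -/
theorem foot_eq_farPole {Ω : Set ℂ} {δ : ℝ} (hδ : 0 < δ) (u : Site 2) (m : Fin 4)
    (h : δ + infDist (meshPoint δ (u + cornerUnit m)) (frontier Ω) ≤ infDist (meshPoint δ u) (frontier Ω))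
    {f : ℂ} (hf : f ∈ frontier Ω)
    (hdist : dist (meshPoint δ (u + cornerUnit m)) f = infDist (meshPoint δ (u + cornerUnit m)) (frontier Ω)) :
    f = meshPoint δ (u + cornerUnit m) +
      (infDist (meshPoint δ (u + cornerUnit m)) (frontier Ω) / δ) • meshPoint δ (cornerUnit m) := by
  set v := u + cornerUnit m with hv
  set ρv := infDist (meshPoint δ v) (frontier Ω) with hρv
  set e := meshPoint δ (cornerUnit m) with he
  set w := f - meshPoint δ v with hw
  have hne : ‖e‖ = δ := by rw [he, norm_meshPoint_cornerUnit, abs_of_pos hδ]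
  have he0 : e ≠ 0 := fun h0 => by rw [h0, norm_zero] at hne; exact hδ.ne' hne.symm
  have hvu : meshPoint δ v = meshPoint δ u + e := by rw [hv, meshPoint_add]
  -- equality in the triangle inequality for `e` and `w`
  have hw_norm : ‖w‖ = ρv := by rw [hw, ← dist_eq_norm, dist_comm, hdist]
  have htri : ‖e + w‖ = ‖e‖ + ‖w‖ := by
    refine le_antisymm (norm_add_le _ _) ?_
    have h1 : infDist (meshPoint δ u) (frontier Ω) ≤ dist (meshPoint δ u) f := infDist_le_dist_of_mem hf
    have h2 : dist (meshPoint δ u) f = ‖e + w‖ := by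
      rw [dist_eq_norm, hw, hvu, show meshPoint δ u - f = -(e + (f - (meshPoint δ u + e))) by ring, norm_neg]
    rw [hne, hw_norm]
    linarith
  obtain ⟨r, hr0, hr⟩ := (sameRay_iff_norm_add.2 htri).exists_nonneg_left he0
  -- `w = r • e` with `r δ = ρv`
  have hr' : r = ρv / δ := by
    have : ‖w‖ = r * δ := by rw [← hr, norm_smul, Real.norm_eq_abs, abs_of_nonneg hr0, hne]
    rw [hw_norm] at this
    field_simp; linarith
  have : f = meshPoint δ v + w := by rw [hw]; ring
  rw [this, ← hr, hr']

/-- **The partner of a degenerate site is unique**: if `v` is degenerate both with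
`v + cornerUnit (m + 2)` (i.e. `v = u + cornerUnit m`) and with `v + cornerUnit (m' + 2)`, then
`m = m'` (the unique foot of `v` is the far pole in both directions). [folklore] -/
theorem eq_of_degenerate_of_degenerate {Ω : Set ℂ} {δ : ℝ} (hδ : 0 < δ) (hne : (frontier Ω).Nonempty)
    (v : Site 2) (m m' : Fin 4) (hpos : 0 < infDist (meshPoint δ v) (frontier Ω))
    (h : δ + infDist (meshPoint δ v) (frontier Ω) ≤ infDist (meshPoint δ (v + cornerUnit (m + 2))) (frontier Ω))
    (h' : δ + infDist (meshPoint δ v) (frontier Ω) ≤ infDist (meshPoint δ (v + cornerUnit (m' + 2))) (frontier Ω)) :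
    m = m' := by
  obtain ⟨f, hf, hfd⟩ := exists_foot hne (meshPoint δ v)
  have hvm : v = v + cornerUnit (m + 2) + cornerUnit m := by
    rw [add_assoc, cornerUnit_add_two, neg_add_cancel, add_zero]
  have hvm' : v = v + cornerUnit (m' + 2) + cornerUnit m' := by
    rw [add_assoc, cornerUnit_add_two, neg_add_cancel, add_zero]
  have h1 := foot_eq_farPole hδ (v + cornerUnit (m + 2)) m (by rw [← hvm]; exact h) hf (by rw [← hvm]; exact hfd.symm)
  have h2 := foot_eq_farPole hδ (v + cornerUnit (m' + 2)) m' (by rw [← hvm']; exact h') hf (by rw [← hvm']; exact hfd.symm)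
  rw [← hvm] at h1
  rw [← hvm'] at h2
  have hρδ : infDist (meshPoint δ v) (frontier Ω) / δ ≠ 0 := (div_pos hpos hδ).ne'
  have h12 : meshPoint δ (cornerUnit m) = meshPoint δ (cornerUnit m') := by
    have := h1.symm.trans h2
    rw [add_right_inj] at this
    exact smul_right_injective ℂ hρδ this
  exact cornerUnit_injective (DiscreteDobrushin.meshPoint_injective hδ.ne' h12)

/-- **A foot on the open edge makes the edge non-degenerate (both ways).** If some boundary point
lies at `δv + t·δ(cornerUnit m)` with `0 < t < 1` and realises `r v` (so `r v = t δ`), then with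
`z = v + cornerUnit m`: `¬ (δ + r v ≤ r z)` and `¬ (δ + r z ≤ r v)`. [folklore] -/
theorem not_degenerate_of_foot_mem_openSegment {Ω : Set ℂ} {δ : ℝ} (hδ : 0 < δ) (v : Site 2)
    (m : Fin 4) {t : ℝ} (ht0 : 0 < t) (ht1 : t < 1)
    (hf : meshPoint δ v + t • meshPoint δ (cornerUnit m) ∈ frontier Ω)
    (hρv : infDist (meshPoint δ v) (frontier Ω) = t * δ) :
    ¬ (δ + infDist (meshPoint δ v) (frontier Ω) ≤ infDist (meshPoint δ (v + cornerUnit m)) (frontier Ω)) ∧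
    ¬ (δ + infDist (meshPoint δ (v + cornerUnit m)) (frontier Ω) ≤ infDist (meshPoint δ v) (frontier Ω)) := by
  have hne : ‖meshPoint δ (cornerUnit m)‖ = δ := by rw [norm_meshPoint_cornerUnit, abs_of_pos hδ]
  have hz : infDist (meshPoint δ (v + cornerUnit m)) (frontier Ω) ≤ (1 - t) * δ := by
    refine (infDist_le_dist_of_mem hf).trans (le_of_eq ?_)
    rw [meshPoint_add, dist_eq_norm, show meshPoint δ v + meshPoint δ (cornerUnit m) -
      (meshPoint δ v + t • meshPoint δ (cornerUnit m)) = (1 - t) • meshPoint δ (cornerUnit m) by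
        rw [sub_smul, one_smul]; ring, norm_smul, Real.norm_eq_abs, abs_of_pos (by linarith), hne]
  have h0 : 0 ≤ infDist (meshPoint δ (v + cornerUnit m)) (frontier Ω) := infDist_nonneg
  constructor <;> intro h <;> nlinarith

/-- **The edge beyond the small site of a degenerate pair is non-degenerate.** If
`δ + r v ≤ r u` with `v = u + cornerUnit m` (and `r v > 0`, `∂Ω ≠ ∅`), then for
`z = v + cornerUnit m`: `¬ (δ + r v ≤ r z)` and `¬ (δ + r z ≤ r v)`. [folklore] -/
theorem not_degenerate_succ_of_degenerate {Ω : Set ℂ} {δ : ℝ} (hδ : 0 < δ) (hne : (frontier Ω).Nonempty)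
    (u : Site 2) (m : Fin 4) (hpos : 0 < infDist (meshPoint δ (u + cornerUnit m)) (frontier Ω))
    (hlt : infDist (meshPoint δ (u + cornerUnit m)) (frontier Ω) < δ)
    (h : δ + infDist (meshPoint δ (u + cornerUnit m)) (frontier Ω) ≤ infDist (meshPoint δ u) (frontier Ω)) :
    ¬ (δ + infDist (meshPoint δ (u + cornerUnit m)) (frontier Ω) ≤
        infDist (meshPoint δ (u + cornerUnit m + cornerUnit m)) (frontier Ω)) ∧
    ¬ (δ + infDist (meshPoint δ (u + cornerUnit m + cornerUnit m)) (frontier Ω) ≤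
        infDist (meshPoint δ (u + cornerUnit m)) (frontier Ω)) := by
  set v := u + cornerUnit m
  set ρv := infDist (meshPoint δ v) (frontier Ω)
  obtain ⟨f, hf, hfd⟩ := exists_foot hne (meshPoint δ v)
  have hfeq := foot_eq_farPole hδ u m h hf hfd.symm
  refine not_degenerate_of_foot_mem_openSegment hδ v m (t := ρv / δ) (div_pos hpos hδ)
    ((div_lt_one hδ).2 hlt) (hfeq ▸ hf) ?_
  rw [div_mul_cancel₀ _ hδ.ne']

/-- **The perpendicular edges at the small site of a degenerate pair are non-degenerate** (and so
is, trivially, any edge at a site of radius `< δ` in the direction "small inside big"): for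
`z = v + cornerUnit m'` with `m' ≠ m` (`v = u + cornerUnit m` degenerate with `u`):
`¬ (δ + r v ≤ r z)` (uniqueness of the partner) and `¬ (δ + r z ≤ r v)` (`r v < δ`).
[folklore] -/
theorem not_degenerate_perp_of_degenerate {Ω : Set ℂ} {δ : ℝ} (hδ : 0 < δ) (hne : (frontier Ω).Nonempty)
    (u : Site 2) (m m' : Fin 4) (hmm' : m' + 2 ≠ m)
    (hpos : 0 < infDist (meshPoint δ (u + cornerUnit m)) (frontier Ω))
    (hlt : infDist (meshPoint δ (u + cornerUnit m)) (frontier Ω) < δ)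
    (h : δ + infDist (meshPoint δ (u + cornerUnit m)) (frontier Ω) ≤ infDist (meshPoint δ u) (frontier Ω)) :
    ¬ (δ + infDist (meshPoint δ (u + cornerUnit m)) (frontier Ω) ≤
        infDist (meshPoint δ (u + cornerUnit m + cornerUnit m')) (frontier Ω)) ∧
    ¬ (δ + infDist (meshPoint δ (u + cornerUnit m + cornerUnit m')) (frontier Ω) ≤
        infDist (meshPoint δ (u + cornerUnit m)) (frontier Ω)) := by
  set v := u + cornerUnit m with hv
  have h0 : 0 ≤ infDist (meshPoint δ (v + cornerUnit m')) (frontier Ω) := infDist_nonneg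
  refine ⟨fun h' => hmm' ?_, fun h' => by linarith⟩
  -- `v` would be degenerate with `v + cornerUnit (m + 2) = u` and with `v + cornerUnit m'`
  have hu : u = v + cornerUnit (m + 2) := by
    rw [hv, add_assoc, cornerUnit_add_two, add_neg_cancel, add_zero]
  have hz : v + cornerUnit m' = v + cornerUnit (m' + 2 + 2) := by
    rw [cornerUnit_add_two, cornerUnit_add_two, neg_neg]
  refine (eq_of_degenerate_of_degenerate hδ hne v m (m' + 2) hpos (hu ▸ h) (hz ▸ h')).symm ▸ ?_
  rfl

end Summit.CriticalPhenomena.CardyFormulaZ2.Theorems.DiscretisationFamilyExists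

end
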